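import Summits.HodgeConjecture.HodgeConjecture.Theorems.F0P6aForwardLawAtChartOfFrame              -- ★ LEG-C at the chart (Theorems currency; LA4-p03 (g2) snippet §1∕§3): `gal_comp_chartSlice_fst_eq_sliceTwo_fst_of_chartOfFrame`
import Summits.HodgeConjecture.HodgeConjecture.Theorems.F0P6aOrganB1FibreLift                -- ★ p850896 ORGAN (B1) `organB1_holds` (LA5-p02 (g4))
import Summits.HodgeConjecture.HodgeConjecture.Theorems.F0P6aOrganB2                          -- ★ p851047 ORGAN (B2) `organB2` (LA4-p02 (g2), over ★ p850979)
import Summits.HodgeConjecture.HodgeConjecture.Theorems.F0P6aOrganB3                          -- ★ p851046 ORGAN (B3) `organB3_holds` (LA6-p02 (g3), over ★ p851009 (B3-SRC) LA4-p03 (g3))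
import Summits.HodgeConjecture.HodgeConjecture.Theorems.F0P6aStubESHEETGlobalGlueDefs       -- ★ p851004 (T) statement layer: `IsSheetTwistOf`, `OrganB1∕B2∕B3`, `OrganSHEETGlobal`, `sheetHom`
import Summits.HodgeConjecture.HodgeConjecture.Theorems.F0P6aStubE6                      -- ★ RE-HOMED E6 layer (Theorems currency): ★ E6-R `rosatiOver_of_ringActionReading`
import Literature.AlgebraicGeometry.ModuliOfAbelianVarieties.SiegelFineModuliTupleIsoOfClassifyingMap -- ★ p851011 + ED. 2 p851174 fine moduli: `exists_iso_baseChange_of_comp_eq_classifyingMap(_mk)`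
import Literature.AlgebraicGeometry.AbelianSchemes.SerreTensorDualPairOfProjective                 -- ★ p850273 (N1) `exists_serreTensor_dualPair_unit`
import Literature.AlgebraicGeometry.ModuliOfAbelianVarieties.SiegelUniversalFamilyProjective        -- ★ p850668 `isProjective_univ_baseChange_hom`
import Literature.AlgebraicGeometry.ShimuraVarieties.UnitaryShimuraCurveHomRigidityOfSpecialFibres   -- ★ p850641 (R-RIG) `forall_comp_eq_comp_of_forall_specialPoint_sheet`
import Literature.AlgebraicGeometry.ShimuraVarieties.UnitaryShimuraCurveSymplecticLiftableOfSpecialFibres -- ★ p850824 (m1): `hasType_and_isSymplecticLiftable_of_forall_specialPoint_sheet` (⊇ ★ p850691 (N3) §3c)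
import Literature.AlgebraicGeometry.ShimuraVarieties.UnitaryAuxiliaryTorusReflexNorm                  -- ★ `Aux.reflexNormFiniteIdele_mem_torusFinAdelic`
import Literature.AlgebraicGeometry.ShimuraVarieties.UnitaryCurveSiegelPointMapTwisted              -- ★ p850526 `UnitaryCurve.exists_pointMap_of_shadow_mul` (the point map `f₂`)
import HarnessLib

/-!
# Crux `HLiu418` — (S8) closer `Lines/F0_P6a_StubESHEET.lean` ED. 2 (tree d582eb44), socket `hole_SHEET_global : OrganSHEETGlobal`, ROAD OF RECORD v3 (γ′)
# «SERRE TENSOR OVER `X`, CLASSIFIED»: **LEG-E(γ′) GLOBAL GLUE — THE PROOF `organSHEETGlobal_of_organs : OrganB1 → OrganB2 → OrganB3 → OrganSHEETGlobal`**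
# (Theorems currency; statement layer = ★ `Theorems.F0P6aStubESHEETGlobalGlueDefs`; LA7-p01 (g4))

Cell `hodgecm-mathlib` (D-0151), FLOOR 0, P6 «MOD», half A line L7∕L4; crux `stmt-HodgeConjecture-24832` (hLiu418); `--supports` only, count-neutral.  LA4-plan (g2) BOOK v3
08:48:23Z, PEN RULING v2 09:59:53Z («ISO» socket text = LA7-p01 frame v1 `OrganSHEETGlobalCore`), (T) GO 10:10:04Z.

THE PROOF ([Shimura1998] §18.6 Thm. 18.6; [Milne2005ShimuraVarieties] Thm. 13.6; [MumfordFogartyKirwan1994] Ch. 7 §2–§3, Ch. 6 §1; [RapoportSmithlingZhang2020Diagonal] §3.2, §4.3):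
1. LEG-A (★ p850615 `exists_serreTwist_moduliTuple_of_isCMField_rowA` on `(P.A, ρ)` over `X`): the Serre-twisted tuple `T_𝔞 = (P.A ⊗ 𝔞⁻¹, λ_B, η_B) ∈ 𝓜_{g,δ,N}(X)` with
   its cover and the rows (t1)(t1′)(surj)(t2)(t3)(t4)(t5)(t5′); its inputs `hdual` (★ p850273 `exists_serreTensor_dualPair_unit` + `hproj` ★ p850668), `hT`∕`hsymp` (ORGAN (B1)
   through ★ p850824 `hasType_and_isSymplecticLiftable_of_forall_specialPoint_sheet`), `hcop`∕`hν` (junction rows, §J′), `rosati` (★ E6-R `rosatiOver_of_ringActionReading`);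
2. `ε₂ :=` the classifying `Fᵢ`-slice of `T_𝔞` (★ `SiegelFineModuliScheme.classifyingMap`, `pullback.lift`); the twisted point map `f₂` (★ p850526); ORGAN (B2) = DEAL #38:
   `ε₂` reads `f₂`;
3. LEG-C (★ `Theorems.F0P6aForwardLawAtChartOfFrame` = LA4-p03 (g2) snippet §1∕§3 over ★ p849999∕p850264; junction idèle in the torus by ★ `reflexNormFiniteIdele_mem_torusFinAdelic`):
   `(1 × Spec γ) ≫ ε ≫ pr₁ = ε₂ ≫ pr₁ = φ_{T_𝔞}`;
4. FINE MODULI (★ p851011 `SiegelFineModuliScheme.exists_iso_baseChange_of_comp_eq_classifyingMap`: classify + ★ `baseChange_isBaseChangeVia` + uniqueness ★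
   `exists_isBaseChangeVia_id` + bridge ★ `exists_iso_of_tupleRel_id`, reduced locally Noetherian base, NO connectedness): `E : P.A ⊗ 𝔞⁻¹ ≅ (P.A) ×_X (1 × Spec γ)` over
   `X`, exact on `λ` and on the level sections;
5. `hact`: ORGAN (B3) = (R-CM) at one special sheet point per component, globalised by (R-RIG) ★ p850641 `forall_comp_eq_comp_of_forall_specialPoint_sheet`.
`organSHEETGlobal_holds : OrganSHEETGlobal` follows by applying the head to the ★ organ payers (`organB1_holds` ★ p850896 LA5-p02 (g4), `organB2_holds` DEAL #45 LA4-p02 (g2),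
`organB3_holds` DEAL #46 LA6-p02 (g3)) — all ★, so this file is SORRY-FREE and `organSHEETGlobal_holds` PAYS the socket text of `hole_SHEET_global`
(closer ED. 3 imports it after the «K3» shim flip; LA4-plan (g2) pre-K3 draft `…cand.ED3.v1.preK3…` 935a6f59).
HONEST LABEL: HC_CM is proved only modulo the 7 printed citations (2 remaining: hLiu418 = stmt-HodgeConjecture-24832, h413 = stmt-HodgeConjecture-24833) until rung 0 closes.
[cite: Shimura1998, §18.6 Thm. 18.6 pp. 124–125, proof pp. 127–129] [cite: Milne2005ShimuraVarieties, §13 Lemma 13.5 and Thm. 13.6 (p. 118)]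
[cite: MumfordFogartyKirwan1994, Ch. 7 §2 Definition 7.2 (p. 129), §3 Theorem 7.9 (p. 139); Ch. 6 §1 Corollary 6.2 (p. 116)] [cite: RapoportSmithlingZhang2020Diagonal, §3.2 p. 11, §4.3 p. 20]
-/

set_option autoImplicit false

noncomputable section

set_option linter.dupNamespace false  -- `Summit.HodgeConjecture.HodgeConjecture.…` BY DESIGN (D-0017)

/-! ## §J′ THE JUNCTION GLUE (closer ED. 1∕2 §1b VERBATIM): (b′) `Nat.Coprime n N` and `n ≠ 0` read off the rows -/

namespace Summit.HodgeConjecture.HodgeConjecture.Theorems.F0P6aStubESHEETGlobalGlue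

open CategoryTheory CategoryTheory.Limits NumberField IsDedekindDomain MulAction AlgebraicGeometry
open scoped Matrix Polynomial Pointwise nonZeroDivisors
open Literature.NumberTheory.GaloisRepresentations
open Summit.HodgeConjecture.HodgeConjecture.Cruxes.HLiu418.F0P6aPELWitnessE

/-! ### §1b GLUE on the junction (PROVED; no socket) -/

/-- A natural number generating the unit ideal of `𝓞 F` is `1` (`|N(d)| = d^{[F:ℚ]} = 1`). [folklore] -/
theorem natCast_eq_one_of_span_eq_top {F : Type} [Field F] [NumberField F] {d : ℕ}
    (hd : Ideal.span {((d : ℕ) : 𝓞 F)} = ⊤) : d = 1 := by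
  have h1 : Ideal.absNorm (Ideal.span {((d : ℕ) : 𝓞 F)}) = 1 := by rw [hd, Ideal.absNorm_top]
  rw [Ideal.absNorm_span_singleton] at h1
  have h2 : ((d : ℕ) : 𝓞 F) = algebraMap ℤ (𝓞 F) (d : ℤ) := by simp
  rw [h2, Algebra.norm_algebraMap, Int.natAbs_pow, Int.natAbs_natCast, NumberField.RingOfIntegers.rank] at h1
  rcases pow_eq_one_iff.mp h1 with h | h
  · exact h
  · exact absurd h (Module.finrank_pos (R := ℚ) (M := F)).ne'

/-- **(b′) from (a)+(b)**: `(n) = 𝔞·c𝔞` and `𝔞 ⊔ (N) = ⊤` give `Nat.Coprime n N` (`c𝔞 ⊔ (N) = ⊤` since `c` fixes `N`, ★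
`mul_pointwise_smul_sup_eq_top_of_sup_span_natCast_eq_top`; then `(gcd n N)` is the unit ideal).  [cite: MilneCM2006, Ch. I §1 Prop. 1.26 (11)] -/
theorem coprime_of_norm_row_of_level_row {F : Type} [Field F] [NumberField F] [IsCMField F] {𝔞 : Ideal (𝓞 F)} {n N : ℕ}
    (ha : Ideal.span {((n : ℕ) : 𝓞 F)} = 𝔞 * (IsCMField.complexConj F) • 𝔞)
    (hb : 𝔞 ⊔ Ideal.span {((N : ℕ) : 𝓞 F)} = ⊤) : Nat.Coprime n N := by
  have htop : Ideal.span {((n : ℕ) : 𝓞 F)} ⊔ Ideal.span {((N : ℕ) : 𝓞 F)} = ⊤ := by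
    rw [ha]
    exact Literature.NumberTheory.NumberFields.mul_pointwise_smul_sup_eq_top_of_sup_span_natCast_eq_top
      (IsCMField.complexConj F) hb
  have hle : Ideal.span {((n : ℕ) : 𝓞 F)} ⊔ Ideal.span {((N : ℕ) : 𝓞 F)} ≤ Ideal.span {((Nat.gcd n N : ℕ) : 𝓞 F)} :=
    sup_le (Ideal.span_singleton_le_span_singleton.mpr (Nat.cast_dvd_cast (Nat.gcd_dvd_left n N)))
      (Ideal.span_singleton_le_span_singleton.mpr (Nat.cast_dvd_cast (Nat.gcd_dvd_right n N)))
  rw [htop, top_le_iff] at hle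
  exact natCast_eq_one_of_span_eq_top hle

/-- **`IsSheetTwistOf.coprime_norm_level`** — the LEVEL-TRANSPORT input (b′) `Nat.Coprime n N` of the X-level Serre twist, READ OFF the junction (rows (a)(b)).
[cite: MilneCM2006, Ch. I §1 Prop. 1.26 (11)] [cite: Shimura1998, §18.6 proof pp. 127–129] -/
theorem IsSheetTwistOf.coprime_norm_level {F : Type} [Field F] [NumberField F] [IsCMField F] {ι₁ : F →+* ℂ}
    {Fi : Type} [Field Fi] [Algebra F Fi] {τE : Fi →+* ℂ} {Φ : Set (F →+* ℂ)} {hΦ : IsCMTypeThrough ι₁ Φ} {N : ℕ}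
    {γ : Fi ≃ₐ[F] Fi} {𝔞 : Ideal (𝓞 F)} {n : ℕ} (h : IsSheetTwistOf ι₁ τE Φ hΦ N γ 𝔞 n) : Nat.Coprime n N :=
  coprime_of_norm_row_of_level_row h.1 h.2.1

/-- **`IsSheetTwistOf.norm_ne_zero`** — `n ≠ 0` from rows (a)(c) (`𝔞 ≠ ⊥`, `c𝔞 ≠ ⊥`, Dedekind domain). [folklore] -/
theorem IsSheetTwistOf.norm_ne_zero {F : Type} [Field F] [NumberField F] [IsCMField F] {ι₁ : F →+* ℂ}
    {Fi : Type} [Field Fi] [Algebra F Fi] {τE : Fi →+* ℂ} {Φ : Set (F →+* ℂ)} {hΦ : IsCMTypeThrough ι₁ Φ} {N : ℕ}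
    {γ : Fi ≃ₐ[F] Fi} {𝔞 : Ideal (𝓞 F)} {n : ℕ} (h : IsSheetTwistOf ι₁ τE Φ hΦ N γ 𝔞 n) : n ≠ 0 := by
  intro hn
  have h0 : 𝔞 * (IsCMField.complexConj F) • 𝔞 ≠ ⊥ :=
    mul_ne_zero h.2.2.1 (Literature.NumberTheory.NumberFields.pointwise_smul_ne_bot (IsCMField.complexConj F) h.2.2.1)
  apply h0
  rw [← h.1, hn, Nat.cast_zero, Ideal.span_singleton_eq_bot]



/-- `sheetHom ι₁ τE hτE` is `τE` on elements. -/
@[simp] theorem sheetHom_apply {F : Type} [Field F] (ι₁ : F →+* ℂ) {Fi : Type} [Field Fi] [Algebra F Fi] (τE : Fi →+* ℂ)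
    (hτE : τE.comp (algebraMap F Fi) = ι₁) (x : Fi) :
    (letI : Algebra F ℂ := ι₁.toAlgebra; sheetHom ι₁ τE hτE x) = τE x := rfl



end Summit.HodgeConjecture.HodgeConjecture.Theorems.F0P6aStubESHEETGlobalGlue

/-! ## §3 THE HEAD — `OrganSHEETGlobal` (tree ED. 2 socket text) from the three organs -/

namespace Summit.HodgeConjecture.HodgeConjecture.Theorems.F0P6aStubESHEETGlobalGlue

open CategoryTheory CategoryTheory.Limits NumberField IsDedekindDomain MulAction AlgebraicGeometry Topology
open scoped Matrix Polynomial Pointwise nonZeroDivisors MonObj  -- `MonObj`: `IsMonHom`∕unit morphisms; it makes `γ` a token (★ `Mod`), hence `γ₁`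
open Literature.NumberTheory.GaloisRepresentations
open Literature.NumberTheory.Automorphic Literature.NumberTheory.Automorphic.UnitaryGroup
open Literature.AlgebraicGeometry.ShimuraVarieties Literature.AlgebraicGeometry.ShimuraVarieties.UnitaryCanonicalModel
open Literature.NumberTheory.Automorphic.Liu2021.AppendixC
open Literature.AlgebraicGeometry.Motives (AlgPoints ComplexPoints SchemeOver thickeningLift specOver CartierDivisor CMType)
open Literature.AlgebraicGeometry.Motives.AbelianVariety (bcSpec)
open Literature.AlgebraicGeometry.AbelianSchemes (PolarizedAbelianSchemeWithLevel AbelianSchemeOver)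
open Literature.AlgebraicGeometry.ModuliOfAbelianVarieties
open Summit.HodgeConjecture.HodgeConjecture.Cruxes.HLiu418.F0P6aPELWitnessE
open Summit.HodgeConjecture.HodgeConjecture.Cruxes.HLiu418.F0P6aStubE6 (RingActionReading)
open Summit.HodgeConjecture.HodgeConjecture.Cruxes.HLiu418.F0P6aChartFramePin (IsChartOfFrame)
open Literature.AlgebraicGeometry.ShimuraVarieties.UnitaryCanonicalModel.Aux (ratBasis torusFinAdelic reflexField numberField_reflexField)
open Literature.AlgebraicGeometry.ShimuraVarieties.UnitaryCurve Literature.AlgebraicGeometry.ShimuraVarieties.UnitaryCurve.AuxV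
open Literature.NumberTheory.ComplexMultiplication (reflexNormFiniteIdele)
open Literature.NumberTheory.ComplexMultiplication.CMTypeOps (flip bar)


/-- Continuation-passing for a `Prop` goal: to prove `G` it suffices to prove every `Goal` that `G` implies.  Used to keep the elaboration
goal ATOMIC while the head destructures its large existential packages — the `cases` motives are then trivial and the head elaborates at the
DEFAULT heartbeat budget (ED. 2, LA4-p01 (g4): `maxHeartbeats 1600000` → none). [folklore] -/
theorem of_forall_imp {G : Prop} (h : ∀ Goal : Prop, (G → Goal) → Goal) : G := h G id

set_option backward.isDefEq.respectTransparency false in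
/-- **HEAD — LEG-E(γ′) GLOBAL GLUE: THE SOCKET TEXT `OrganSHEETGlobal` (tree closer ED. 2 §3c, «ISO») FROM THE ORGANS (B1)(B2)(B3).**  LEG-A ★ p850615 (with `hdual` ★ p850273 + ★ p850668, `hT`∕`hsymp` from
(B1) via ★ p850691 + §0, `hcop`∕`hν` from the junction, `rosati` ★ E6-R) gives `T_𝔞` and the rows; `ε₂ :=` its classifying `Fᵢ`-slice; (B2) + ★ p850526 (`f₂`) + LEG-C
(§1, ★ p850264) give `(1 × Spec γ) ≫ ε ≫ pr₁ = φ_{T_𝔞}`; fine moduli (★ `exists_isBaseChangeVia_classifyingMap`, ★ `baseChange_isBaseChangeVia`, ★ `IsBaseChangeVia.trans`,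
★ `exists_isBaseChangeVia_id`, bridge ★ `exists_iso_of_tupleRel_id` — packaged as ★ `SiegelFineModuliScheme.exists_iso_baseChange_of_comp_eq_classifyingMap`) give the
isomorphism `E : P ⊗ 𝔞⁻¹ ≅ P ×_X gγ` exact on `λ` and on the level sections; (B3) + (R-RIG) ★ p850641 give `hact`.
[cite: Shimura1998, §18.6 Thm. 18.6 pp. 124–125, proof pp. 127–129] [cite: Milne2005ShimuraVarieties, §13 Thm. 13.6 (p. 118)]
[cite: MumfordFogartyKirwan1994, Ch. 7 §2 Definition 7.2 (p. 129), §3 Theorem 7.9 (p. 139); Ch. 6 §1 Corollary 6.2 (p. 116)] [cite: RapoportSmithlingZhang2020Diagonal, §3.2 p. 11, §4.3 p. 20] -/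
theorem organSHEETGlobal_of_organs (hB1 : OrganB1) (hB2 : OrganB2) (hB3 : OrganB3) : OrganSHEETGlobal := by
  intro F _ _ _ _ ι₁ Jstar hJ hJu K₀ S hU7ₛ Kc Fi _ _ _ _ τE hτE Φ hΦ C ξ k Fr hpin ε hε ρ hρ γ₁ 𝔞 n htw
  -- ED. 2 (heartbeat cure): continuation-passing — the goal becomes an atomic `Goal` with `kont : ⟨socket ∃-body⟩ → Goal`, so every `obtain` below has a
  -- trivial motive; the witness is handed to `kont` at the end.  Nothing else in the proof changes.
  refine of_forall_imp fun Goal kont => ?_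
  letI : Algebra F ℂ := ι₁.toAlgebra
  -- (the statement՚s `P`, `X`, `gγ` are SPELLED OUT below — a `let` for them makes the organ sockets՚ instance binders expensive to match; comments keep the short names)
  -- the base `X := (S.M Kc) ⊗_F Fᵢ` is reduced and locally Noetherian; `P.A` is commutative
  haveI := S.smooth Kc
  haveI : Smooth (S.M.obj Kc).hom := SmoothOfRelativeDimension.smooth 1 _
  haveI hXsm : Smooth ((Literature.AlgebraicGeometry.Motives.baseChange F Fi).obj (S.M.obj Kc)).hom := by
    change Smooth (pullback.snd (S.M.obj Kc).hom _)
    infer_instance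
  haveI : IsLocallyNoetherian ((Literature.AlgebraicGeometry.Motives.baseChange F Fi).obj (S.M.obj Kc)).left :=
    LocallyOfFiniteType.isLocallyNoetherian ((Literature.AlgebraicGeometry.Motives.baseChange F Fi).obj (S.M.obj Kc)).hom
  haveI : IsReduced ((Literature.AlgebraicGeometry.Motives.baseChange F Fi).obj (S.M.obj Kc)).left :=
    Literature.AlgebraicGeometry.Motives.isReduced_of_smooth_over_field
      ((Literature.AlgebraicGeometry.Motives.baseChange F Fi).obj (S.M.obj Kc)).hom
  haveI hcomm : IsCommMonObj (C.𝓜.univ.baseChange (ε.left ≫ pullback.fst C.𝓜.M.hom (bcSpec ℚ Fi))).A.X :=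
    AbelianSchemeOver.isCommMonObj_of_isLocallyNoetherian_base _
  haveI : CharZero Fi := charZero_of_injective_algebraMap (algebraMap F Fi).injective
  -- the sheet as an `F`-algebra hom
  let eE : Fi →ₐ[F] ℂ := sheetHom ι₁ τE hτE
  have heE : ∀ x, eE x = τE x := fun _ => rfl
  -- σR from σ1 (★ E6-R)
  have hros := Summit.HodgeConjecture.HodgeConjecture.Cruxes.HLiu418.F0P6aStubE6.rosatiOver_of_ringActionReading hτE C ε ρ hρ
  -- the junction
  have hν : n ≠ 0 := IsSheetTwistOf.norm_ne_zero htw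
  have hcop : Nat.Coprime n C.N := IsSheetTwistOf.coprime_norm_level htw
  have hN0 : C.N ≠ 0 := by have := C.hN; omega
  have htw' := htw
  obtain ⟨hrow_a, hrow_b, hrow_c, γ', sE, z, hγτ, hγι, hart, hzt, hz𝔞, hzN⟩ := htw'
  -- the junction՚s idèle lies in the torus (`z = t(sE)`, ★ `reflexNormFiniteIdele_mem_torusFinAdelic`)
  haveI : NumberField ↥(reflexField F (twistType ι₁ Φ hΦ) ι₁) := numberField_reflexField F (twistType ι₁ Φ hΦ) ι₁
  have hzmem : z ∈ torusFinAdelic F := by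
    rw [hzt]
    exact Literature.AlgebraicGeometry.ShimuraVarieties.UnitaryCanonicalModel.Aux.reflexNormFiniteIdele_mem_torusFinAdelic F (twistType ι₁ Φ hΦ) ι₁ sE
  let tz : ↥(torusFinAdelic F) := ⟨z, hzmem⟩
  have htz : (tz : (FiniteAdeleRing (𝓞 F) F)ˣ) = z := rfl
  -- `hproj` (★ p850668) and `hdual` (★ p850273)
  have hproj := C.𝓜.isProjective_univ_baseChange_hom C.hδ C.quasiProjective_M (ε.left ≫ pullback.fst C.𝓜.M.hom (bcSpec ℚ Fi))
  -- `X` over `ℚ` is locally Noetherian (the test class of `classify`)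
  haveI hXℚ : IsLocallyNoetherian (Over.mk (((Literature.AlgebraicGeometry.Motives.baseChange F Fi).obj (S.M.obj Kc)).hom ≫ bcSpec ℚ Fi) : SchemeOver ℚ).left :=
    inferInstanceAs (IsLocallyNoetherian ((Literature.AlgebraicGeometry.Motives.baseChange F Fi).obj (S.M.obj Kc)).left)
  haveI hXℚr : IsReduced (Over.mk (((Literature.AlgebraicGeometry.Motives.baseChange F Fi).obj (S.M.obj Kc)).hom ≫ bcSpec ℚ Fi) : SchemeOver ℚ).left :=
    inferInstanceAs (IsReduced ((Literature.AlgebraicGeometry.Motives.baseChange F Fi).obj (S.M.obj Kc)).left)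
  -- the three organs, SPECIALISED to the context once (the remaining telescopes are the presentation data)
  have hB1' := hB1 F ι₁ Jstar hJ hJu K₀ S hU7ₛ Kc Fi τE hτE Φ hΦ C ξ k Fr hpin ε hε ρ hρ 𝔞 n tz hrow_c hrow_a hrow_b hz𝔞 hzN
  have hB2' := hB2 F ι₁ Jstar hJ hJu K₀ S hU7ₛ Kc Fi τE hτE Φ hΦ C ξ k Fr hpin ε hε ρ hρ 𝔞 n tz hrow_c hrow_a hrow_b hz𝔞 hzN
  have hB3' := hB3 F ι₁ Jstar hJ hJu K₀ S hU7ₛ Kc Fi τE hτE Φ hΦ C ξ k Fr hpin ε hε ρ hρ γ₁ 𝔞 n htw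
  -- LEG-A (★ p850615), its three binders discharged: `hdual` now, `hT`∕`hsymp` from (B1)
  obtain ⟨m, E', hE', Pm, Qm, Db, hDb, polB, lvl', hP, hQ, hQP, hPQ, hspan, hrel, hTB, hsB, ht1, ht1', hsurj, ht2, ht3, ht4,
      ht5, ht5', -, -⟩ :=
    AbelianSchemeOver.exists_serreTwist_moduliTuple_of_isCMField_rowA ρ (C.𝓜.univ.baseChange (ε.left ≫ pullback.fst C.𝓜.M.hom (bcSpec ℚ Fi))).D (C.𝓜.univ.baseChange (ε.left ≫ pullback.fst C.𝓜.M.hom (bcSpec ℚ Fi))).hatNormalised (C.𝓜.univ.baseChange (ε.left ≫ pullback.fst C.𝓜.M.hom (bcSpec ℚ Fi))).pol ((Literature.AlgebraicGeometry.Motives.baseChange F Fi).obj (S.M.obj Kc)).hom hros (C.𝓜.univ.baseChange (ε.left ≫ pullback.fst C.𝓜.M.hom (bcSpec ℚ Fi))).relDim (C.𝓜.univ.baseChange (ε.left ≫ pullback.fst C.𝓜.M.hom (bcSpec ℚ Fi))).level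
      hrow_c hν hrow_a hcop
      (fun E' hE' Pm Qm hP hQ hQP hPQ hspan =>
        AbelianSchemeOver.exists_serreTensor_dualPair_unit ((Literature.AlgebraicGeometry.Motives.baseChange F Fi).obj (S.M.obj Kc)).hom (C.𝓜.univ.baseChange (ε.left ≫ pullback.fst C.𝓜.M.hom (bcSpec ℚ Fi))).A hproj (C.𝓜.univ.baseChange (ε.left ≫ pullback.fst C.𝓜.M.hom (bcSpec ℚ Fi))).D (C.𝓜.univ.baseChange (ε.left ≫ pullback.fst C.𝓜.M.hom (bcSpec ℚ Fi))).pol ρ E' hE' Pm Qm hν hP hQ hQP hPQ)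
      (fun E' hE' Pm Qm hP hQ hQP hPQ hspan Db hDb polB hex => by
        obtain ⟨lvl', h5, -⟩ := (C.𝓜.univ.baseChange (ε.left ≫ pullback.fst C.𝓜.M.hom (bcSpec ℚ Fi))).level.existsUnique_serreTwist ρ E' hE' Pm Qm hν hP hQ hQP hPQ hcop
        exact (S.hasType_and_isSymplecticLiftable_of_forall_specialPoint_sheet Kc τE hτE eE heE
          (AbelianSchemeOver.isOfRelDim_serreTensor ρ E' hE' Pm Qm hν hP hQ hQP hPQ (C.𝓜.univ.baseChange (ε.left ≫ pullback.fst C.𝓜.M.hom (bcSpec ℚ Fi))).relDim) lvl' hN0 polB C.hδ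
          (hB1' _ E' hE' Pm Qm hP hQ hQP hPQ hspan Db hDb polB lvl' hex h5 eE heE)).1)
      (fun E' hE' Pm Qm hP hQ hQP hPQ hspan Db hDb polB lvl' hex h5 =>
        (S.hasType_and_isSymplecticLiftable_of_forall_specialPoint_sheet Kc τE hτE eE heE
          (AbelianSchemeOver.isOfRelDim_serreTensor ρ E' hE' Pm Qm hν hP hQ hQP hPQ (C.𝓜.univ.baseChange (ε.left ≫ pullback.fst C.𝓜.M.hom (bcSpec ℚ Fi))).relDim) lvl' hN0 polB C.hδ
          (hB1' _ E' hE' Pm Qm hP hQ hQP hPQ hspan Db hDb polB lvl' hex h5 eE heE)).2)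
  have hex : AbelianSchemeOver.IsExactTwistPol ρ E' hE' Pm (C.𝓜.univ.baseChange (ε.left ≫ pullback.fst C.𝓜.M.hom (bcSpec ℚ Fi))).D Db (C.𝓜.univ.baseChange (ε.left ≫ pullback.fst C.𝓜.M.hom (bcSpec ℚ Fi))).pol n polB.lam :=
    (AbelianSchemeOver.isExactTwistPol_iff ρ E' hE' Pm (C.𝓜.univ.baseChange (ε.left ≫ pullback.fst C.𝓜.M.hom (bcSpec ℚ Fi))).D Db (C.𝓜.univ.baseChange (ε.left ≫ pullback.fst C.𝓜.M.hom (bcSpec ℚ Fi))).pol n polB.lam).mpr ht3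
  -- the twisted tuple `T_𝔞 ∈ 𝓜_{g,δ,N}(X)`, its classifying map `φ` over `ℚ` and the `Fᵢ`-slice `ε₂`
  let T𝔞 : PolarizedAbelianSchemeWithLevel C.g C.N C.δ ((Literature.AlgebraicGeometry.Motives.baseChange F Fi).obj (S.M.obj Kc)).left :=
    ⟨AbelianSchemeOver.serreTensor ρ E' hE', hrel, Db, polB, hTB, lvl', hsB, hDb⟩
  obtain ⟨φ, hφ⟩ : ∃ φ : (Over.mk (((Literature.AlgebraicGeometry.Motives.baseChange F Fi).obj (S.M.obj Kc)).hom ≫ bcSpec ℚ Fi) : SchemeOver ℚ) ⟶ C.𝓜.M, φ = C.𝓜.classifyingMap (Over.mk (((Literature.AlgebraicGeometry.Motives.baseChange F Fi).obj (S.M.obj Kc)).hom ≫ bcSpec ℚ Fi) : SchemeOver ℚ) T𝔞 := ⟨_, rfl⟩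
  have wφ : φ.left ≫ C.𝓜.M.hom = ((Literature.AlgebraicGeometry.Motives.baseChange F Fi).obj (S.M.obj Kc)).hom ≫ bcSpec ℚ Fi := Over.w φ
  let ε₂ : ((Literature.AlgebraicGeometry.Motives.baseChange F Fi).obj (S.M.obj Kc)) ⟶ (Literature.AlgebraicGeometry.Motives.baseChange ℚ Fi).obj C.𝓜.M :=
    Over.homMk (pullback.lift φ.left ((Literature.AlgebraicGeometry.Motives.baseChange F Fi).obj (S.M.obj Kc)).hom wφ) (pullback.lift_snd _ _ _)
  have hε₂fst : ε₂.left ≫ pullback.fst C.𝓜.M.hom (bcSpec ℚ Fi) = φ.left := pullback.lift_fst _ _ _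
  -- the twisted point map `f₂` with shadow `[C.J v, C.b a · ũ_V(1, z)]` (★ p850526; `C.b a` and `ũ_V(1,z)` commute under the pin)
  have hcommb : ∀ a : GSAdele F Jstar, C.b a * auxToGspFinV Fr (1, tz) = auxToGspFinV Fr (1, tz) * C.b a := fun a => by
    rw [hpin.2.1]
    simp only [MonoidHom.comp_apply, MonoidHom.inl_apply, ← map_mul, Prod.mk_mul_mk, one_mul, mul_one]
  obtain ⟨f₂, hf₂⟩ := UnitaryCurve.exists_pointMap_of_shadow_mul C.J C.hJ C.b C.bq C.hJsmul C.hb C.hJrat Kc.1.1 C.hle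
    (auxToGspFinV Fr (1, tz)) (fun a _ => hcommb a) C.𝓜.M C.pts
  -- (B2): `ε₂` reads `f₂`
  have hread := hB2' _ E' hE' Pm Qm hP hQ hQP hPQ hspan Db hDb polB lvl' hrel hTB hsB hex ht5 ε₂ (hε₂fst.trans (by rw [hφ])) f₂ hf₂
  -- LEG-C (★ `F0P6aForwardLawAtChartOfFrame`, over ★ p850264): `(1 × Spec γ) ≫ ε ≫ pr₁ = ε₂ ≫ pr₁ = φ`
  have hLegC := Summit.HodgeConjecture.HodgeConjecture.Theorems.F0P6aForwardLawAtChartOfFrame.gal_comp_chartSlice_fst_eq_sliceTwo_fst_of_chartOfFrame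
    hJ hJu hτE hΦ C hpin ε hε γ₁ γ' hγτ hγι sE hart tz
    (htz.trans hzt) f₂ hf₂ ε₂ hread
  have hφeq : (Literature.AlgebraicGeometry.Motives.GaloisDescent.gal Fi (S.M.obj Kc) γ₁⁻¹) ≫ ε.left ≫ pullback.fst C.𝓜.M.hom (bcSpec ℚ Fi) = φ.left := hLegC.trans hε₂fst
  -- FINE MODULI (★ `SiegelFineModuliTupleIsoOfClassifyingMap` ED. 2 `…_mk`, the unpackaged-base form of ★ p851011): `T_𝔞 ≅ P ×_X gγ`, exact on `λ` and on the level sections.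
  -- (Two-step application: the lemma is specialised BEFORE the classifying-map equation is fed in — feeding it inline makes the
  -- elaborator compare `(Over.mk _).left` with the pulled-back base the expensive way.)
  have key : (Literature.AlgebraicGeometry.Motives.GaloisDescent.gal Fi (S.M.obj Kc) γ₁⁻¹) ≫ (ε.left ≫ pullback.fst C.𝓜.M.hom (bcSpec ℚ Fi)) =
      (C.𝓜.classifyingMap (Over.mk (((Literature.AlgebraicGeometry.Motives.baseChange F Fi).obj (S.M.obj Kc)).hom ≫ bcSpec ℚ Fi) : SchemeOver ℚ) T𝔞).left := hφeq.trans (by rw [hφ])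
  have hXn : IsLocallyNoetherian ((Literature.AlgebraicGeometry.Motives.baseChange F Fi).obj (S.M.obj Kc)).left := inferInstance
  have hXr : IsReduced ((Literature.AlgebraicGeometry.Motives.baseChange F Fi).obj (S.M.obj Kc)).left := inferInstance
  have hfm := @SiegelFineModuliScheme.exists_iso_baseChange_of_comp_eq_classifyingMap_mk _ _ _ C.𝓜 _ (((Literature.AlgebraicGeometry.Motives.baseChange F Fi).obj (S.M.obj Kc)).hom ≫ bcSpec ℚ Fi)
    hXℚ hXn hXr T𝔞 (ε.left ≫ pullback.fst C.𝓜.M.hom (bcSpec ℚ Fi)) (Literature.AlgebraicGeometry.Motives.GaloisDescent.gal Fi (S.M.obj Kc) γ₁⁻¹)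
  have hE := hfm key
  obtain ⟨E, hmon, hlam, hσ⟩ := hE
  haveI := hmon
  -- (B3) + (R-RIG) ★ p850641: `E` intertwines `serreAction` and `ρ^γ` (specialise, then feed — same elaboration-order discipline)
  have hB3E := hB3' _ E' hE' Pm Qm hP hQ hQP hPQ hspan Db hDb polB lvl' hex ht5 E hmon
  have hB3E' := hB3E hlam hσ eE heE
  have hrig := S.forall_comp_eq_comp_of_forall_specialPoint_sheet Kc τE hτE eE heE (AbelianSchemeOver.serreAction ρ E' hE')
    (ρ.baseChange (Literature.AlgebraicGeometry.Motives.GaloisDescent.gal Fi (S.M.obj Kc) γ₁⁻¹)) E.hom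
  have hact : ∀ b : 𝓞 F, (AbelianSchemeOver.serreAction ρ E' hE').i b ≫ E.hom = E.hom ≫ (ρ.baseChange (Literature.AlgebraicGeometry.Motives.GaloisDescent.gal Fi (S.M.obj Kc) γ₁⁻¹)).i b := hrig hB3E'
  exact kont ⟨AbelianSchemeOver.serreTensor ρ E' hE', AbelianSchemeOver.serreAction ρ E' hE', Db, hDb, polB, lvl',
    AbelianSchemeOver.serreTranslate ρ E' hE' Pm, AbelianSchemeOver.isMonHom_serreTranslate ρ E' hE' Pm,
    ht1, ht1', hsurj, ht2, ht3, ht4, ht5, ht5', E, hmon, hlam, hσ, hact⟩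

/-- **`organSHEETGlobal_holds : OrganSHEETGlobal` — THE SOCKET TEXT OF `hole_SHEET_global` IS PAID** (tree closer ED. 2 §3c, «ISO» currency): the head applied to the
three ★ organ payers `organB1_holds` (★ p850896, LA5-p02 (g4)), `organB2` (★ p851047 over ★ p850979, LA4-p02 (g2)), `organB3_holds` (★ p851046 over ★ p851009, LA6-p02
(g3) ∕ LA4-p03 (g3)) — each typed against ★ `Theorems.F0P6aStubESHEETGlobalGlueDefs` (LA4-r01 (g2) #66 kernel probe).  Closer ED. 3: `theorem hole_SHEET_global :
OrganSHEETGlobal := …organSHEETGlobal_holds` after the «K3» shim flip (the closer՚s `IsSheetTwistOf`∕`OrganSHEETGlobal` and this module՚s are delta-equal over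
then-identical constants).  [cite: Shimura1998, §18.6 Thm. 18.6 pp. 124–125, proof pp. 127–129] [cite: Milne2005ShimuraVarieties, §13 Thm. 13.6 (p. 118)]
[cite: MumfordFogartyKirwan1994, Ch. 7 §3 Theorem 7.9 (p. 139); Ch. 6 §1 Corollary 6.2 (p. 116)] -/
theorem organSHEETGlobal_holds : OrganSHEETGlobal :=
  organSHEETGlobal_of_organs
    Summit.HodgeConjecture.HodgeConjecture.Theorems.F0P6aOrganB1FibreLift.organB1_holds
    Summit.HodgeConjecture.HodgeConjecture.Theorems.F0P6aOrganB2.organB2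
    Summit.HodgeConjecture.HodgeConjecture.Theorems.F0P6aOrganB3.organB3_holds

end Summit.HodgeConjecture.HodgeConjecture.Theorems.F0P6aStubESHEETGlobalGlue

end
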